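import Literature.Computability.Cryptography.LiuPassCondEPPRG
import HarnessLib

/-!
# Inaccessible entropy from one-way functions: the hashed-prefix function of Haitner–Holenstein–Reingold–Vadhan–Wee (Thm. 4.5), combinatorial core

Topic `Literature/Computability/Cryptography`. First file of a proof of **"one-way functions ⇒ universal
one-way hash functions"** (Rompel 1990; the direction of Goldreich 2004, Thm. 6.4.29 whose proof the
book omits, p. 267: "its proof is too complex to fit in this work") along the route of
Haitner–Holenstein–Reingold–Vadhan–Wee, *Inaccessible Entropy II: IE Functions and Universal One-Way
Hashing*, Theory of Computing 16(8), 2020 (= EUROCRYPT 2010), Theorem 4.5 + Theorem 5.1. This file is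
purely combinatorial (finite sums; no machines, no asymptotics): it proves, for ONE input length, the
three claims behind **Theorem 4.5** — the function

  `F(x, κ, i) = (h_κ(f x)_{1..i}, κ, i)`   (`f : 𝒳 → 𝒴` arbitrary, `h_κ` from a 3-wise independent
  family, `i` a uniform prefix length below `M`)

has a noticeable gap between the real Shannon entropy of `F⁻¹` and its accessible average
max-entropy, *witnessed by the explicit set family* `L(x, κ, i)` of Eq. (4.4)–(4.5) and *modulo the
success probability of an explicit inverter for `f`*. The hash family enters only through the abstract
"hashed `i`-prefix" map `hp κ i y` and the two counting hypotheses `PrefixPairwise` / `PrefixThreewise`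
(pairwise / three-wise independence of prefixes on distinct images, §2.4); the lightness threshold `T`
is the paper's `n^c`. Everything is stated as an inequality between finite sums with explicit constants:

* objects: `imgCard f y = |f⁻¹(y)|`; the sibling set `sib` (= first components of `F⁻¹(F(z))`); `IsLight`
  (`|f⁻¹(y)| · T · 2^i ≤ |𝒳|`, i.e. `H_{f(X)}(y) ≥ i + log₂ T`); the accessible set `acc` (= `L(z)`);
  `collPairs f = #{(x,x') : f x = f x'}` (collision count of `f`); `plantKeys` (the key set `G_{y,x,i}` of
  the inverter), `invSum` (its un-normalised success count), `escCount` (`#{(z, r) : A(z; r) ∉ L(z)}`).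
* **Claim 4.8** `card_le_sum_indicator_div_card_sib`: if `f x ≠ f x*`, `2^i |f⁻¹(f x*)| ≤ |𝒳|` and
  `|f⁻¹(f x)| ≤ |f⁻¹(f x*)|`, then `Σ_κ 1[x* ∈ S(x,κ,i)] / |S(x,κ,i)| ≥ |𝒦| / (3|𝒳|)` (constant `1/3`
  by Cauchy–Schwarz in place of the printed `1/8` by Markov; counting step `sum_card_sib_mul_le`).
* **Claim 4.7** `sum_logb_card_acc_add_le`: if `|𝒳| < 2^M`, `T ≥ 1` and `8 · collPairs f · T ≤ |𝒳|²`, then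
  `Σ_{x,κ,i} log₂|L| + |𝒳||𝒦| ⌊log₂ T⌋ / 12 ≤ Σ_{x,κ,i} log₂|S|`, i.e. an average gap of
  `⌊log₂ T⌋ / (12 M)` bits (the paper's `Ω(c log n / n)`); via Eq. (4.14) (`sub_div_le_logb_sub_logb`,
  `le_logb_two_one_add`), the window count `log_le_card_window` (Eq. (4.15)) and Claim 4.8; the final
  estimate uses `collPairs` directly (heavy points are few since `Σ_x |f⁻¹(f x)| = collPairs`).
* **Claim 4.6** `card_mul_escCount_le`: for every `F`-collision finder `A` (output always an `i`-prefix
  sibling), `|𝒳| · escCount ≤ T · |𝒦| · invSum`, i.e. `Pr[A(Z;R) ∉ L(Z)] ≤ T · Pr[Inv^A inverts f]`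
  (Eq. (4.7)–(4.9)).

Deviations from the printed text, all inessential and recorded in the docstrings: `f` need not be
length-preserving and its codomain is arbitrary (the hash is applied to images); prefix lengths range
over `{0, …, M−1}` with `|𝒳| < 2^M` instead of `[n]`; one-wayness is replaced at this level by the two
quantitative hypotheses it implies (few collisions; the inverter's success count), to be discharged
asymptotically by the machine-level files. No named facts are introduced; all statements are proved.

## References

* I. Haitner, T. Holenstein, O. Reingold, S. Vadhan, H. Wee, *Inaccessible Entropy II: IE Functions and
  Universal One-Way Hashing*, Theory of Computing 16(8) (2020) 1–55, doi:10.4086/toc.2020.v016a008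
  (EUROCRYPT 2010, LNCS 6110, 616–637): §2.3–2.4, Def. 3.1–3.9, Thm. 4.5, Claims 4.6–4.8 (pp. 21–25).
* J. Rompel, *One-way functions are necessary and sufficient for secure signatures*, STOC 1990, 387–394.
* J. Katz, C.-Y. Koo, *On constructing universal one-way hash functions from arbitrary one-way
  functions*, Cryptology ePrint Archive 2005/328.
* O. Goldreich, *Foundations of Cryptography II: Basic Applications*, CUP 2004, §6.4.3, Thm. 6.4.29.
-/

namespace Literature.Computability.Cryptography

namespace HHRVW

open Finset Real

variable {𝒳 𝒴 𝒦 P : Type*}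

/-! ### The objects of Theorem 4.5 -/

section ImgCard

variable [Fintype 𝒳] [DecidableEq 𝒴]

/-- `imgCard f y = |f⁻¹(y)|`, the number of preimages of `y` (so the sample entropy of the image is
`H_{f(X)}(y) = log₂ (|𝒳| / |f⁻¹(y)|)`). [cite: HaitnerEtAl2020, §2.3 and footnote 7] -/
def imgCard (f : 𝒳 → 𝒴) (y : 𝒴) : ℕ := (fiber univ f y).card

/-- `y` is `i`-light (with threshold `T`, the paper's `n^c`): `|f⁻¹(y)| · T · 2^i ≤ |𝒳|`, i.e.
`H_{f(X)}(y) ≥ i + log₂ T`. [cite: HaitnerEtAl2020, Eq. (4.5)] -/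
def IsLight (f : 𝒳 → 𝒴) (T i : ℕ) (y : 𝒴) : Prop := imgCard f y * T * 2 ^ i ≤ Fintype.card 𝒳

/-- Lightness is decidable (an inequality of naturals). [folklore] -/
instance (f : 𝒳 → 𝒴) (T i : ℕ) (y : 𝒴) : Decidable (IsLight f T i y) := Nat.decLe _ _

/-- `imgCard f (f x) = #{x' | f x' = f x}`. [folklore] -/
theorem imgCard_apply (f : 𝒳 → 𝒴) (x : 𝒳) : imgCard f (f x) = (univ.filter fun x' => f x' = f x).card := rfl

/-- `0 < |f⁻¹(f x)|`. [folklore] -/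
theorem imgCard_pos (f : 𝒳 → 𝒴) (x : 𝒳) : 0 < imgCard f (f x) :=
  card_fiber_pos f (Finset.mem_univ x)

end ImgCard

section Sib

variable [Fintype 𝒳] [DecidableEq P]

/-- The sibling set `S(x, κ, i) = {x' : h_κ(f x')_{1..i} = h_κ(f x)_{1..i}}`, i.e. the first components of
`F⁻¹(F(x, κ, i))` for `F(x, κ, i) = (h_κ(f x)_{1..i}, κ, i)`; here `hp κ i y` abstracts "the `i`-bit
prefix of `h_κ(y)`". [cite: HaitnerEtAl2020, Thm. 4.5 (the function `F`)] -/
def sib (f : 𝒳 → 𝒴) (hp : 𝒦 → ℕ → 𝒴 → P) (x : 𝒳) (κ : 𝒦) (i : ℕ) : Finset 𝒳 :=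
  univ.filter fun x' => hp κ i (f x') = hp κ i (f x)

variable (f : 𝒳 → 𝒴) (hp : 𝒦 → ℕ → 𝒴 → P)

/-- `x ∈ S(x, κ, i)`. [cite: HaitnerEtAl2020, Def. 3.3 (an `F`-collision finder may output `x` itself)] -/
theorem self_mem_sib (x : 𝒳) (κ : 𝒦) (i : ℕ) : x ∈ sib f hp x κ i := by
  simp [sib]

/-- Membership in the sibling set. [cite: HaitnerEtAl2020, Thm. 4.5] -/
@[simp] theorem mem_sib {x x' : 𝒳} {κ : 𝒦} {i : ℕ} :
    x' ∈ sib f hp x κ i ↔ hp κ i (f x') = hp κ i (f x) := by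
  simp [sib]

/-- Sibling sets are nonempty. [cite: HaitnerEtAl2020, Thm. 4.5] -/
theorem card_sib_pos (x : 𝒳) (κ : 𝒦) (i : ℕ) : 0 < (sib f hp x κ i).card :=
  Finset.card_pos.2 ⟨x, self_mem_sib f hp x κ i⟩

end Sib

section Acc

variable [Fintype 𝒳] [DecidableEq 𝒴] [DecidableEq P]

/-- The accessible set `L(x, κ, i) = {x' ∈ S(x, κ, i) : f x' ∈ L̃(f x, i)}` where
`L̃(y, i) = {y} ∪ {i-light images}`. [cite: HaitnerEtAl2020, Eq. (4.4)–(4.5)] -/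
def acc (f : 𝒳 → 𝒴) (hp : 𝒦 → ℕ → 𝒴 → P) (T : ℕ) (x : 𝒳) (κ : 𝒦) (i : ℕ) : Finset 𝒳 :=
  (sib f hp x κ i).filter fun x' => f x' = f x ∨ IsLight f T i (f x')

variable (f : 𝒳 → 𝒴) (hp : 𝒦 → ℕ → 𝒴 → P)

/-- `L(x, κ, i) ⊆ S(x, κ, i)`. [cite: HaitnerEtAl2020, Eq. (4.4)] -/
theorem acc_subset_sib (T : ℕ) (x : 𝒳) (κ : 𝒦) (i : ℕ) : acc f hp T x κ i ⊆ sib f hp x κ i :=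
  Finset.filter_subset _ _

/-- `x ∈ L(x, κ, i)`. [cite: HaitnerEtAl2020, Def. 3.9 (`x ∈ L(x)`)] -/
theorem self_mem_acc (T : ℕ) (x : 𝒳) (κ : 𝒦) (i : ℕ) : x ∈ acc f hp T x κ i := by
  simp [acc, sib]

/-- Accessible sets are nonempty. [cite: HaitnerEtAl2020, Def. 3.9] -/
theorem card_acc_pos (T : ℕ) (x : 𝒳) (κ : 𝒦) (i : ℕ) : 0 < (acc f hp T x κ i).card :=
  Finset.card_pos.2 ⟨x, self_mem_acc f hp T x κ i⟩

/-- Membership in the accessible set. [cite: HaitnerEtAl2020, Eq. (4.4)] -/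
@[simp] theorem mem_acc {T : ℕ} {x x' : 𝒳} {κ : 𝒦} {i : ℕ} :
    x' ∈ acc f hp T x κ i ↔ hp κ i (f x') = hp κ i (f x) ∧ (f x' = f x ∨ IsLight f T i (f x')) := by
  simp [acc, sib]

/-- **Escaping `L`.** A sibling `x'` of `x` lies outside `L(x, κ, i)` iff its image differs from `f x`
and is not `i`-light — the event counted by `escCount` below. [cite: HaitnerEtAl2020, Eq. (4.4)–(4.6)] -/
theorem not_mem_acc_iff {T : ℕ} {x x' : 𝒳} {κ : 𝒦} {i : ℕ} (hx' : hp κ i (f x') = hp κ i (f x)) :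
    x' ∉ acc f hp T x κ i ↔ f x' ≠ f x ∧ ¬ IsLight f T i (f x') := by
  rw [mem_acc]
  tauto

end Acc

section Indep

variable [Fintype 𝒦] [DecidableEq P]

/-- Pairwise independence of hashed prefixes on distinct images: for `f x ≠ f x'`,
`Pr_κ[h_κ(f x')_{1..i} = h_κ(f x)_{1..i}] = 2^{-i}` (`i < M`). [cite: HaitnerEtAl2020, §2.4 and proof of Claim 4.6
("since `G` is two-wise independent")] -/
def PrefixPairwise (f : 𝒳 → 𝒴) (hp : 𝒦 → ℕ → 𝒴 → P) (M : ℕ) : Prop :=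
  ∀ i < M, ∀ x x' : 𝒳, f x ≠ f x' →
    (univ.filter fun κ => hp κ i (f x') = hp κ i (f x)).card * 2 ^ i = Fintype.card 𝒦

/-- Three-wise independence of hashed prefixes on distinct images: for pairwise distinct
`f x, f x', f x''`, `Pr_κ[h_κ(f x')_{1..i} = h_κ(f x)_{1..i} ∧ h_κ(f x'')_{1..i} = h_κ(f x)_{1..i}] = 4^{-i}`.
[cite: HaitnerEtAl2020, §2.4 and Claim 4.8 ("by the three-wise independence of `G`")] -/
def PrefixThreewise (f : 𝒳 → 𝒴) (hp : 𝒦 → ℕ → 𝒴 → P) (M : ℕ) : Prop :=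
  ∀ i < M, ∀ x x' x'' : 𝒳, f x ≠ f x' → f x ≠ f x'' → f x' ≠ f x'' →
    (univ.filter fun κ => hp κ i (f x') = hp κ i (f x) ∧ hp κ i (f x'') = hp κ i (f x)).card * 4 ^ i =
      Fintype.card 𝒦

end Indep

/-! ### Claim 4.8: a designated heavier sibling is hit with probability `≥ 1/(3|𝒳|)` -/

section Claim48

variable [Fintype 𝒳] [DecidableEq 𝒴] [Fintype 𝒦] [DecidableEq P]
variable {f : 𝒳 → 𝒴} {hp : 𝒦 → ℕ → 𝒴 → P} {M : ℕ}

/-- Counting step of Claim 4.8: over the keys `κ` under which `x*` is a sibling of `x`, the total size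
of the sibling sets is at most `3 · 2^{-i} · |𝒳|` per key — the preimages of `f x` and of `f x*`
contribute at most `2^{-i}|𝒳|` each (`|f⁻¹(f x)| ≤ |f⁻¹(f x*)| ≤ 2^{-i}|𝒳|`), and every third image is
an `i`-prefix sibling with conditional probability `2^{-i}` by three-wise independence.
[cite: HaitnerEtAl2020, Claim 4.8, Eq. (4.11)–(4.12)] -/
theorem sum_card_sib_mul_le (h2 : PrefixPairwise f hp M) (h3 : PrefixThreewise f hp M)
    {i : ℕ} (hi : i < M) {x xs : 𝒳} (hne : f x ≠ f xs)
    (hfit : imgCard f (f xs) * 2 ^ i ≤ Fintype.card 𝒳) (hle : imgCard f (f x) ≤ imgCard f (f xs)) :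
    (∑ κ ∈ univ.filter (fun κ => hp κ i (f xs) = hp κ i (f x)), (sib f hp x κ i).card) * 2 ^ i ≤
      3 * (univ.filter (fun κ => hp κ i (f xs) = hp κ i (f x))).card * Fintype.card 𝒳 := by
  set E := univ.filter (fun κ => hp κ i (f xs) = hp κ i (f x)) with hE
  have hEcard : E.card * 2 ^ i = Fintype.card 𝒦 := h2 i hi x xs hne
  -- exchange the order of summation
  have h1 : ∑ κ ∈ E, (sib f hp x κ i).card =
      ∑ x' : 𝒳, (E.filter fun κ => hp κ i (f x') = hp κ i (f x)).card := by
    simp only [sib, Finset.card_filter]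
    exact Finset.sum_comm
  -- termwise bound
  have h2' : ∀ x' : 𝒳, (E.filter fun κ => hp κ i (f x') = hp κ i (f x)).card * 2 ^ i ≤
      if f x' = f x ∨ f x' = f xs then E.card * 2 ^ i else E.card := by
    intro x'
    split_ifs with hx'
    · exact Nat.mul_le_mul_right _ (Finset.card_filter_le _ _)
    · push Not at hx'
      have hcnt := h3 i hi x xs x' hne (Ne.symm hx'.1) (Ne.symm hx'.2)
      -- `#{κ | both} * 4^i = |𝒦| = |E| * 2^i`
      have hEq : (E.filter fun κ => hp κ i (f x') = hp κ i (f x)) =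
          univ.filter fun κ => hp κ i (f xs) = hp κ i (f x) ∧ hp κ i (f x') = hp κ i (f x) := by
        rw [hE, Finset.filter_filter]
      rw [hEq]
      have h4 : (4 : ℕ) ^ i = 2 ^ i * 2 ^ i := by
        rw [← mul_pow]; norm_num
      rw [h4, ← hEcard, ← mul_assoc] at hcnt
      exact (Nat.eq_of_mul_eq_mul_right (pow_pos (by norm_num) i) hcnt).le
  -- sum the termwise bounds
  have h3' : (∑ x' : 𝒳, (E.filter fun κ => hp κ i (f x') = hp κ i (f x)).card) * 2 ^ i ≤
      ∑ x' : 𝒳, (if f x' = f x ∨ f x' = f xs then E.card * 2 ^ i else E.card) := by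
    rw [Finset.sum_mul]
    exact Finset.sum_le_sum fun x' _ => h2' x'
  -- evaluate the right-hand side
  have h4' : ∑ x' : 𝒳, (if f x' = f x ∨ f x' = f xs then E.card * 2 ^ i else E.card) ≤
      (imgCard f (f x) + imgCard f (f xs)) * (E.card * 2 ^ i) + Fintype.card 𝒳 * E.card := by
    have hsplit : ∀ x' : 𝒳, (if f x' = f x ∨ f x' = f xs then E.card * 2 ^ i else E.card) ≤
        (if f x' = f x ∨ f x' = f xs then E.card * 2 ^ i else 0) + E.card := by
      intro x'
      split_ifs <;> omega
    refine (Finset.sum_le_sum fun x' _ => hsplit x').trans ?_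
    rw [Finset.sum_add_distrib, Finset.sum_const, Finset.card_univ, smul_eq_mul, ← Finset.sum_filter,
      Finset.sum_const, smul_eq_mul]
    refine Nat.add_le_add_right (Nat.mul_le_mul_right _ ?_) _
    rw [imgCard, imgCard, fiber, fiber, Finset.card_filter, Finset.card_filter, Finset.card_filter,
      ← Finset.sum_add_distrib]
    refine Finset.sum_le_sum fun x' _ => ?_
    by_cases hp1 : f x' = f x <;> by_cases hp2 : f x' = f xs <;> simp [hp1, hp2]
  have h5 : (imgCard f (f x) + imgCard f (f xs)) * 2 ^ i ≤ 2 * Fintype.card 𝒳 := by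
    have := Nat.mul_le_mul_right (2 ^ i) hle
    rw [Nat.add_mul]
    omega
  rw [h1]
  calc (∑ x' : 𝒳, (E.filter fun κ => hp κ i (f x') = hp κ i (f x)).card) * 2 ^ i
      ≤ (imgCard f (f x) + imgCard f (f xs)) * (E.card * 2 ^ i) + Fintype.card 𝒳 * E.card :=
        h3'.trans h4'
    _ = ((imgCard f (f x) + imgCard f (f xs)) * 2 ^ i) * E.card + Fintype.card 𝒳 * E.card := by ring
    _ ≤ (2 * Fintype.card 𝒳) * E.card + Fintype.card 𝒳 * E.card :=
        Nat.add_le_add_right (Nat.mul_le_mul_right _ h5) _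
    _ = 3 * E.card * Fintype.card 𝒳 := by ring

/-- **Claim 4.8** (HHRVW 2020). If `f x ≠ f x*`, `i ≤ H_{f(X)}(f x*) ≤ H_{f(X)}(f x)` (i.e.
`2^i |f⁻¹(f x*)| ≤ |𝒳|` and `|f⁻¹(f x)| ≤ |f⁻¹(f x*)|`), then a uniform sibling of `x` under a uniform
key equals `x*` with probability at least `1/(3|𝒳|)`:
`Σ_κ 1[x* ∈ S(x,κ,i)] / |S(x,κ,i)| ≥ |𝒦| / (3|𝒳|)` (membership `x* ∈ S(x,κ,i)` written out as the
prefix equation, `mem_sib`; the paper has the constant `1/8` via Markov; the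
Cauchy–Schwarz/Jensen form gives `1/3`). [cite: HaitnerEtAl2020, Claim 4.8] -/
theorem card_le_sum_indicator_div_card_sib [Nonempty 𝒦] (h2 : PrefixPairwise f hp M)
    (h3 : PrefixThreewise f hp M) {i : ℕ} (hi : i < M) {x xs : 𝒳} (hne : f x ≠ f xs)
    (hfit : imgCard f (f xs) * 2 ^ i ≤ Fintype.card 𝒳) (hle : imgCard f (f x) ≤ imgCard f (f xs)) :
    (Fintype.card 𝒦 : ℝ) ≤
      3 * Fintype.card 𝒳 *
        ∑ κ, (if hp κ i (f xs) = hp κ i (f x) then (1 : ℝ) else 0) / ((sib f hp x κ i).card : ℝ) := by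
  set E := univ.filter (fun κ => hp κ i (f xs) = hp κ i (f x)) with hE
  have hEcard : E.card * 2 ^ i = Fintype.card 𝒦 := h2 i hi x xs hne
  set V : 𝒦 → ℝ := fun κ => ((sib f hp x κ i).card : ℝ) with hV
  have hVpos : ∀ κ, 0 < V κ := fun κ => by
    simp only [hV]
    exact_mod_cast card_sib_pos f hp x κ i
  -- the sum is `Σ_{κ ∈ E} 1 / V κ`
  have hsum : ∑ κ, (if hp κ i (f xs) = hp κ i (f x) then (1 : ℝ) else 0) / ((sib f hp x κ i).card : ℝ) =
      ∑ κ ∈ E, 1 ^ 2 / V κ := by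
    rw [hE, Finset.sum_filter]
    refine Finset.sum_congr rfl fun κ _ => ?_
    by_cases hκ : hp κ i (f xs) = hp κ i (f x)
    · rw [if_pos hκ, if_pos hκ, one_pow]
    · rw [if_neg hκ, if_neg hκ, zero_div]
  -- Cauchy–Schwarz (Sedrakyan): `|E|² / Σ_E V ≤ Σ_E 1/V`
  have hCS : (∑ κ ∈ E, (1 : ℝ)) ^ 2 / ∑ κ ∈ E, V κ ≤ ∑ κ ∈ E, 1 ^ 2 / V κ :=
    Finset.sq_sum_div_le_sum_sq_div E (fun _ => (1 : ℝ)) fun κ _ => hVpos κ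
  rw [Finset.sum_const, nsmul_eq_mul, mul_one] at hCS
  -- the counting bound, in `ℝ`
  have hcnt : (∑ κ ∈ E, V κ) * 2 ^ i ≤ 3 * E.card * Fintype.card 𝒳 := by
    have h := sum_card_sib_mul_le h2 h3 hi hne hfit hle
    rw [← hE] at h
    have h' : (((∑ κ ∈ E, (sib f hp x κ i).card) * 2 ^ i : ℕ) : ℝ) ≤ ((3 * E.card * Fintype.card 𝒳 : ℕ) : ℝ) := by
      exact_mod_cast h
    push_cast at h'
    simpa [hV] using h'
  -- `E` is nonempty (`|E| 2^i = |𝒦| > 0`)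
  have hEpos : (0 : ℝ) < E.card := by
    have : 0 < E.card := by
      rcases Nat.eq_zero_or_pos E.card with h0 | h0
      · exfalso
        rw [h0, zero_mul] at hEcard
        exact Fintype.card_ne_zero hEcard.symm
      · exact h0
    exact_mod_cast this
  have hSVpos : 0 < ∑ κ ∈ E, V κ :=
    Finset.sum_pos (fun κ _ => hVpos κ) (Finset.card_pos.1 (by exact_mod_cast hEpos))
  have hX : (0 : ℝ) < Fintype.card 𝒳 := by
    have : 0 < Fintype.card 𝒳 := Fintype.card_pos_iff.2 ⟨x⟩
    exact_mod_cast this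
  -- combine
  rw [hsum]
  have hK : (Fintype.card 𝒦 : ℝ) = E.card * 2 ^ i := by exact_mod_cast hEcard.symm
  rw [hK]
  have step1 : (E.card : ℝ) ^ 2 ≤ (∑ κ ∈ E, V κ) * ∑ κ ∈ E, 1 ^ 2 / V κ := by
    rw [div_le_iff₀ hSVpos] at hCS
    linarith [hCS]
  have step2 : (E.card : ℝ) ^ 2 * 2 ^ i ≤ 3 * E.card * Fintype.card 𝒳 * ∑ κ ∈ E, 1 ^ 2 / V κ := by
    have hS0 : 0 ≤ ∑ κ ∈ E, 1 ^ 2 / V κ := Finset.sum_nonneg fun κ _ => by positivity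
    calc (E.card : ℝ) ^ 2 * 2 ^ i ≤ (∑ κ ∈ E, V κ) * (∑ κ ∈ E, 1 ^ 2 / V κ) * 2 ^ i :=
          mul_le_mul_of_nonneg_right step1 (by positivity)
      _ = (∑ κ ∈ E, V κ) * 2 ^ i * ∑ κ ∈ E, 1 ^ 2 / V κ := by ring
      _ ≤ 3 * E.card * Fintype.card 𝒳 * ∑ κ ∈ E, 1 ^ 2 / V κ :=
          mul_le_mul_of_nonneg_right hcnt hS0
  -- cancel one factor `|E|`
  have step3 : (E.card : ℝ) * ((E.card : ℝ) * 2 ^ i) ≤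
      (E.card : ℝ) * (3 * Fintype.card 𝒳 * ∑ κ ∈ E, 1 ^ 2 / V κ) := by
    calc (E.card : ℝ) * ((E.card : ℝ) * 2 ^ i) = (E.card : ℝ) ^ 2 * 2 ^ i := by ring
      _ ≤ 3 * E.card * Fintype.card 𝒳 * ∑ κ ∈ E, 1 ^ 2 / V κ := step2
      _ = (E.card : ℝ) * (3 * Fintype.card 𝒳 * ∑ κ ∈ E, 1 ^ 2 / V κ) := by ring
  exact le_of_mul_le_mul_left step3 hEpos

end Claim48

/-! ### Claim 4.7: the accessible sets are noticeably smaller than the sibling sets on average -/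

section Claim47

/-- `log₂ (1 + α) ≥ α` on `[0, 1]` (concavity; Bernoulli's inequality `2^α ≤ 1 + α`).
The paper uses "`log(1 + α) ≥ α/2` for `α` between `0` and `1`".
[cite: HaitnerEtAl2020, proof of Claim 4.7, Eq. (4.14)] -/
theorem le_logb_two_one_add {α : ℝ} (h0 : 0 ≤ α) (h1 : α ≤ 1) : α ≤ Real.logb 2 (1 + α) := by
  have h := rpow_one_add_le_one_add_mul_self (s := (1 : ℝ)) (by norm_num) h0 h1
  rw [mul_one, show (1 : ℝ) + 1 = 2 by norm_num] at h
  calc α = Real.logb 2 ((2 : ℝ) ^ α) := (Real.logb_rpow (by norm_num) (by norm_num)).symm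
    _ ≤ Real.logb 2 (1 + α) := Real.logb_le_logb_of_le (by norm_num) (by positivity) h

/-- For `1 ≤ a ≤ b`: `(b - a)/b ≤ log₂ b − log₂ a`. [cite: HaitnerEtAl2020, Eq. (4.14)] -/
theorem sub_div_le_logb_sub_logb {a b : ℕ} (ha : 0 < a) (hab : a ≤ b) :
    ((b : ℝ) - a) / b ≤ Real.logb 2 b - Real.logb 2 a := by
  have haR : (0 : ℝ) < a := by exact_mod_cast ha
  have hbR : (a : ℝ) ≤ b := by exact_mod_cast hab
  have hb0 : (0 : ℝ) < b := lt_of_lt_of_le haR hbR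
  set α : ℝ := ((b : ℝ) - a) / b with hα
  have hα0 : 0 ≤ α := div_nonneg (by linarith) hb0.le
  have hα1 : α ≤ 1 := by
    rw [hα, div_le_one hb0]; linarith
  have h1 : α ≤ Real.logb 2 (1 + α) := le_logb_two_one_add hα0 hα1
  have h2 : 1 + α ≤ (b : ℝ) / a := by
    rw [hα, le_div_iff₀ haR]
    have : ((b : ℝ) - a) / b * a ≤ ((b : ℝ) - a) / b * b :=
      mul_le_mul_of_nonneg_left hbR hα0
    rw [div_mul_cancel₀ _ hb0.ne'] at this
    linarith
  have h3 : Real.logb 2 (1 + α) ≤ Real.logb 2 ((b : ℝ) / a) :=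
    Real.logb_le_logb_of_le (by norm_num) (by linarith) h2
  rw [Real.logb_div hb0.ne' haR.ne'] at h3
  linarith

/-- **The window of useful prefix lengths.** If `N T ≤ 2X` and `X < 2^M` (`N, T ≥ 1`), at least
`⌊log₂ T⌋` prefix lengths `i < M` satisfy `N · 2^i ≤ X < N · T · 2^i` (i.e.
`i ≤ H_{f(X)}(y) < i + log₂ T` for an image with `N` preimages). [cite: HaitnerEtAl2020, proof of Claim 4.7,
Eq. (4.15) ("`Σ_{i ≤ H(f(x*)) < i + c log n}`")] -/
theorem log_le_card_window {N T X M : ℕ} (hN : 0 < N) (hT : 0 < T) (hNT : N * T ≤ 2 * X)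
    (hX : X < 2 ^ M) :
    Nat.log 2 T ≤ ((Finset.range M).filter fun i => N * 2 ^ i ≤ X ∧ X < N * T * 2 ^ i).card := by
  set lam := Nat.log 2 T with hlam
  rcases Nat.eq_zero_or_pos lam with h0 | hpos
  · rw [h0]; exact Nat.zero_le _
  have h2lam : 2 ^ lam ≤ T := Nat.pow_log_le_self 2 hT.ne'
  set e := Nat.log 2 (X / N) with he
  -- `2^(lam-1) * N ≤ X`, hence `lam - 1 ≤ e` and `X / N ≠ 0`
  have hlamN : 2 ^ (lam - 1) * N ≤ X := by
    have h1 : 2 ^ lam * N ≤ 2 * X := by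
      calc 2 ^ lam * N ≤ T * N := Nat.mul_le_mul_right _ h2lam
        _ = N * T := mul_comm _ _
        _ ≤ 2 * X := hNT
    have h2 : 2 ^ lam = 2 * 2 ^ (lam - 1) := by
      rw [← pow_succ']; congr 1; omega
    rw [h2, mul_assoc] at h1
    exact Nat.le_of_mul_le_mul_left h1 (by norm_num)
  have hXN : X / N ≠ 0 := by
    intro h
    rw [Nat.div_eq_zero_iff_lt hN] at h
    have : 1 * N ≤ X := le_trans (Nat.mul_le_mul_right _ (Nat.one_le_two_pow)) hlamN
    omega
  have hle_e : lam - 1 ≤ e := by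
    rw [he, Nat.le_log_iff_pow_le one_lt_two hXN, Nat.le_div_iff_mul_le hN]
    exact hlamN
  -- `N * 2^e ≤ X < N * 2^(e+1)`
  have heX : N * 2 ^ e ≤ X := by
    have := Nat.pow_log_le_self 2 hXN
    rw [← he, Nat.le_div_iff_mul_le hN] at this
    rw [mul_comm]; exact this
  have hXe : X < N * 2 ^ (e + 1) := by
    have := Nat.lt_pow_succ_log_self one_lt_two (X / N)
    rw [← he, Nat.div_lt_iff_lt_mul hN] at this
    rw [mul_comm]; exact this
  -- the window contains `Ico (e + 1 - lam) (e + 1)`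
  have hsub : Finset.Ico (e + 1 - lam) (e + 1) ⊆
      (Finset.range M).filter fun i => N * 2 ^ i ≤ X ∧ X < N * T * 2 ^ i := by
    intro i hi
    rw [Finset.mem_Ico] at hi
    rw [Finset.mem_filter, Finset.mem_range]
    have hi1 : N * 2 ^ i ≤ X :=
      le_trans (Nat.mul_le_mul_left _ (Nat.pow_le_pow_right (by norm_num) (by omega))) heX
    refine ⟨?_, hi1, ?_⟩
    · have : 2 ^ i < 2 ^ M := lt_of_le_of_lt (le_trans (Nat.le_mul_of_pos_left _ hN) hi1) hX
      exact (Nat.pow_lt_pow_iff_right (by norm_num)).1 this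
    · calc X < N * 2 ^ (e + 1) := hXe
        _ ≤ N * 2 ^ (lam + i) := Nat.mul_le_mul_left _ (Nat.pow_le_pow_right (by norm_num) (by omega))
        _ = N * 2 ^ lam * 2 ^ i := by rw [pow_add, mul_assoc]
        _ ≤ N * T * 2 ^ i := Nat.mul_le_mul_right _ (Nat.mul_le_mul_left _ h2lam)
  calc lam = (Finset.Ico (e + 1 - lam) (e + 1)).card := by rw [Nat.card_Ico]; omega
    _ ≤ _ := Finset.card_le_card hsub

variable [Fintype 𝒳] [DecidableEq 𝒴] [DecidableEq P]

/-- `collPairs f = #{(x, x') : f x' = f x} = Σ_x |f⁻¹(f x)|`, the number of ordered colliding pairs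
(including the diagonal); `collPairs f / |𝒳|²` is the collision probability of `f(X)`, which for a
one-way `f` is negligible ("otherwise inverting `f` is trivial"). [cite: HaitnerEtAl2020, end of proof of Claim 4.7] -/
def collPairs (f : 𝒳 → 𝒴) : ℕ := ∑ x, imgCard f (f x)

variable {f : 𝒳 → 𝒴} {hp : 𝒦 → ℕ → 𝒴 → P} {M : ℕ}

/-- The escaping siblings: `|S(x,κ,i)| − |L(x,κ,i)| = #{x* : x* ∈ S(x,κ,i), f x* ≠ f x, f x* not i-light}`.
[cite: HaitnerEtAl2020, proof of Claim 4.7 (`L̄(z) := F⁻¹(F(z)) ∖ L(z)`)] -/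
theorem card_sib_sub_card_acc (T : ℕ) (x : 𝒳) (κ : 𝒦) (i : ℕ) :
    (((sib f hp x κ i).card - (acc f hp T x κ i).card : ℕ) : ℝ) =
      ∑ xs, if hp κ i (f xs) = hp κ i (f x) ∧ (f xs ≠ f x ∧ ¬ IsLight f T i (f xs)) then (1 : ℝ) else 0 := by
  have h := Finset.card_filter_add_card_filter_not (s := sib f hp x κ i)
    (fun x' => f x' = f x ∨ IsLight f T i (f x'))
  have hacc : (acc f hp T x κ i).card = ((sib f hp x κ i).filter fun x' => f x' = f x ∨ IsLight f T i (f x')).card := rfl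
  have hsub : (sib f hp x κ i).card - (acc f hp T x κ i).card =
      ((sib f hp x κ i).filter fun x' => ¬ (f x' = f x ∨ IsLight f T i (f x'))).card := by
    rw [hacc]; omega
  rw [hsub, sib, Finset.filter_filter, Finset.card_filter]
  push_cast
  refine Finset.sum_congr rfl fun xs _ => ?_
  simp only [not_or]

variable [Fintype 𝒦]

/-- **Claim 4.7** (HHRVW 2020), summed form. With `i` uniform below `M` where `|𝒳| < 2^M`, a lightness
threshold `T ≥ 1`, three-wise independent hashed prefixes and few collisions
(`8 · #{(x,x') : f x = f x'} · T ≤ |𝒳|²`), the accessible sets are smaller than the sibling sets by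
`⌊log₂ T⌋ / 12` bits on average:
`Σ_{x,κ,i} log₂ |L(x,κ,i)| + |𝒳| |𝒦| ⌊log₂ T⌋ / 12 ≤ Σ_{x,κ,i} log₂ |S(x,κ,i)|`
(the paper: `E[log |L(Z)|] ≤ E[log |F⁻¹(F(Z))|] − Ω(c log n / n)` with `T = n^c`, `M = n`).
[cite: HaitnerEtAl2020, Claim 4.7 with Claim 4.8 and Eq. (4.13)–(4.15)] -/
theorem sum_logb_card_acc_add_le [Nonempty 𝒦] (h2 : PrefixPairwise f hp M) (h3 : PrefixThreewise f hp M)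
    (hM : Fintype.card 𝒳 < 2 ^ M) {T : ℕ} (hT : 0 < T) (hCP : 8 * collPairs f * T ≤ Fintype.card 𝒳 ^ 2) :
    (∑ x, ∑ κ, ∑ i : Fin M, Real.logb 2 (acc f hp T x κ i).card) +
        Fintype.card 𝒳 * Fintype.card 𝒦 * Nat.log 2 T / 12 ≤
      ∑ x, ∑ κ, ∑ i : Fin M, Real.logb 2 (sib f hp x κ i).card := by
  classical
  -- empty domain: everything vanishes
  rcases isEmpty_or_nonempty 𝒳 with hE | hE
  · simp
  set X := Fintype.card 𝒳 with hXdef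
  set K := Fintype.card 𝒦 with hKdef
  set lam := Nat.log 2 T with hlam
  have hX0 : (0 : ℝ) < X := by rw [hXdef]; exact_mod_cast Fintype.card_pos
  have hK0 : (0 : ℝ) < K := by rw [hKdef]; exact_mod_cast Fintype.card_pos
  -- the escape indicator
  set ind : 𝒳 → 𝒦 → ℕ → 𝒳 → ℝ := fun x κ i xs =>
    if hp κ i (f xs) = hp κ i (f x) ∧ (f xs ≠ f x ∧ ¬ IsLight f T i (f xs)) then 1 else 0 with hind
  have hind0 : ∀ x κ i xs, 0 ≤ ind x κ i xs := fun x κ i xs => by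
    simp only [hind]; split_ifs <;> norm_num
  -- Steps 1–2 (Eq. (4.14)): pointwise `Σ_xs ind / |S| ≤ log₂|S| − log₂|L|`
  have hpt : ∀ (x : 𝒳) (κ : 𝒦) (i : ℕ), (∑ xs, ind x κ i xs) / ((sib f hp x κ i).card : ℝ) ≤
      Real.logb 2 (sib f hp x κ i).card - Real.logb 2 (acc f hp T x κ i).card := by
    intro x κ i
    have hsub : (∑ xs, ind x κ i xs) = (((sib f hp x κ i).card - (acc f hp T x κ i).card : ℕ) : ℝ) := by
      rw [card_sib_sub_card_acc T x κ i]
    rw [hsub, Nat.cast_sub (Finset.card_le_card (acc_subset_sib f hp T x κ i))]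
    exact sub_div_le_logb_sub_logb (card_acc_pos f hp T x κ i)
      (Finset.card_le_card (acc_subset_sib f hp T x κ i))
  -- Step 3 (Eq. (4.15) with Claim 4.8): for a good pair `(x, x*)` the window contributes `⌊log₂ T⌋ · K/(3X)`
  have hinner : ∀ x xs : 𝒳, (f x ≠ f xs ∧ imgCard f (f x) ≤ imgCard f (f xs) ∧ imgCard f (f xs) * T ≤ 2 * X) →
      (lam : ℝ) * (K / (3 * X)) ≤ ∑ i : Fin M, ∑ κ, ind x κ i xs / ((sib f hp x κ i).card : ℝ) := by
    rintro x xs ⟨hne, hle, hNT⟩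
    have hrange : ∑ i : Fin M, ∑ κ, ind x κ i xs / ((sib f hp x κ i).card : ℝ) =
        ∑ i ∈ Finset.range M, ∑ κ, ind x κ i xs / ((sib f hp x κ i).card : ℝ) :=
      Fin.sum_univ_eq_sum_range (fun i => ∑ κ, ind x κ i xs / ((sib f hp x κ i).card : ℝ)) M
    rw [hrange]
    set W := (Finset.range M).filter fun i => imgCard f (f xs) * 2 ^ i ≤ X ∧ X < imgCard f (f xs) * T * 2 ^ i
      with hW
    have hWcard : lam ≤ W.card := log_le_card_window (imgCard_pos f xs) hT hNT hM
    have hWsub : W ⊆ Finset.range M := Finset.filter_subset _ _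
    have hnonneg : ∀ i ∈ Finset.range M, i ∉ W → 0 ≤ ∑ κ, ind x κ i xs / ((sib f hp x κ i).card : ℝ) :=
      fun i _ _ => Finset.sum_nonneg fun κ _ => div_nonneg (hind0 x κ i xs) (Nat.cast_nonneg _)
    refine le_trans ?_ (Finset.sum_le_sum_of_subset_of_nonneg hWsub hnonneg)
    have hterm : ∀ i ∈ W, (K : ℝ) / (3 * X) ≤ ∑ κ, ind x κ i xs / ((sib f hp x κ i).card : ℝ) := by
      intro i hi
      rw [hW, Finset.mem_filter, Finset.mem_range] at hi
      obtain ⟨hiM, hfit, hnl⟩ := hi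
      have hesc : f xs ≠ f x ∧ ¬ IsLight f T i (f xs) := ⟨hne.symm, fun hl => absurd hl (not_le.2 hnl)⟩
      have hind' : ∀ κ, ind x κ i xs = if hp κ i (f xs) = hp κ i (f x) then 1 else 0 := by
        intro κ
        simp only [hind]
        by_cases hq : hp κ i (f xs) = hp κ i (f x)
        · rw [if_pos ⟨hq, hesc⟩, if_pos hq]
        · rw [if_neg (fun h => hq h.1), if_neg hq]
      simp_rw [hind']
      have h48 := card_le_sum_indicator_div_card_sib h2 h3 hiM hne hfit hle
      rw [div_le_iff₀ (by positivity)]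
      linarith
    calc (lam : ℝ) * (K / (3 * X)) ≤ W.card * (K / (3 * X)) :=
          mul_le_mul_of_nonneg_right (by exact_mod_cast hWcard) (by positivity)
      _ = ∑ i ∈ W, (K : ℝ) / (3 * X) := by rw [Finset.sum_const, nsmul_eq_mul]
      _ ≤ ∑ i ∈ W, ∑ κ, ind x κ i xs / ((sib f hp x κ i).card : ℝ) := Finset.sum_le_sum hterm
  -- Step 4: at least `X²/4` good pairs
  set G : 𝒳 → 𝒳 → ℝ := fun x xs =>
    if f x ≠ f xs ∧ imgCard f (f x) ≤ imgCard f (f xs) ∧ ¬ (2 * X < imgCard f (f xs) * T) then 1 else 0 with hG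
  have hA : (X : ℝ) ^ 2 ≤ 2 * ∑ x, ∑ xs, (if imgCard f (f x) ≤ imgCard f (f xs) then (1 : ℝ) else 0) := by
    have hsym : ∑ x, ∑ xs, (if imgCard f (f x) ≤ imgCard f (f xs) then (1 : ℝ) else 0) =
        ∑ x, ∑ xs, (if imgCard f (f xs) ≤ imgCard f (f x) then (1 : ℝ) else 0) := Finset.sum_comm
    have h1 : ∀ x xs : 𝒳, (1 : ℝ) ≤ (if imgCard f (f x) ≤ imgCard f (f xs) then (1 : ℝ) else 0) +
        (if imgCard f (f xs) ≤ imgCard f (f x) then (1 : ℝ) else 0) := by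
      intro x xs
      rcases le_total (imgCard f (f x)) (imgCard f (f xs)) with h | h <;> simp only [h, if_true] <;>
        split_ifs <;> norm_num
    calc (X : ℝ) ^ 2 = ∑ x : 𝒳, ∑ xs : 𝒳, (1 : ℝ) := by
          rw [Finset.sum_const, Finset.card_univ, nsmul_eq_mul, Finset.sum_const, Finset.card_univ,
            nsmul_eq_mul, mul_one, ← hXdef, sq]
      _ ≤ ∑ x, ∑ xs, ((if imgCard f (f x) ≤ imgCard f (f xs) then (1 : ℝ) else 0) +
            (if imgCard f (f xs) ≤ imgCard f (f x) then (1 : ℝ) else 0)) :=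
          Finset.sum_le_sum fun x _ => Finset.sum_le_sum fun xs _ => h1 x xs
      _ = 2 * ∑ x, ∑ xs, (if imgCard f (f x) ≤ imgCard f (f xs) then (1 : ℝ) else 0) := by
          simp only [Finset.sum_add_distrib]
          rw [← hsym]; ring
  have hB : (∑ x, ∑ xs, (if f x = f xs then (1 : ℝ) else 0)) = collPairs f := by
    rw [collPairs]; push_cast
    refine Finset.sum_congr rfl fun x _ => ?_
    rw [imgCard_apply, Finset.card_filter]; push_cast
    refine Finset.sum_congr rfl fun xs _ => ?_
    simp only [eq_comm]
  have hCPR : (8 : ℝ) * collPairs f * T ≤ (X : ℝ) ^ 2 := by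
    rw [hXdef]; exact_mod_cast hCP
  have hT1 : (1 : ℝ) ≤ T := by exact_mod_cast hT
  have hB' : (collPairs f : ℝ) ≤ (X : ℝ) ^ 2 / 8 := by
    have : (collPairs f : ℝ) ≤ collPairs f * T := le_mul_of_one_le_right (Nat.cast_nonneg _) hT1
    linarith
  have hC : (∑ x : 𝒳, ∑ xs, (if 2 * X < imgCard f (f xs) * T then (1 : ℝ) else 0)) ≤ (X : ℝ) ^ 2 / 16 := by
    rw [Finset.sum_const, Finset.card_univ, nsmul_eq_mul, ← hXdef]
    have hHv : 2 * (X : ℝ) * (∑ xs, (if 2 * X < imgCard f (f xs) * T then (1 : ℝ) else 0)) ≤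
        collPairs f * T := by
      rw [Finset.mul_sum, collPairs]; push_cast; rw [Finset.sum_mul]
      refine Finset.sum_le_sum fun xs _ => ?_
      split_ifs with h
      · rw [mul_one]; exact_mod_cast h.le
      · rw [mul_zero]; positivity
    linarith
  have hgoodpt : ∀ x xs : 𝒳, (if imgCard f (f x) ≤ imgCard f (f xs) then (1 : ℝ) else 0) -
      (if f x = f xs then (1 : ℝ) else 0) - (if 2 * X < imgCard f (f xs) * T then (1 : ℝ) else 0) ≤ G x xs := by
    intro x xs
    simp only [hG]
    by_cases ha : imgCard f (f x) ≤ imgCard f (f xs) <;> by_cases hb : f x = f xs <;>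
      by_cases hc : 2 * X < imgCard f (f xs) * T <;> simp [ha, hb, hc]
  have hgoodcount : (X : ℝ) ^ 2 / 4 ≤ ∑ x, ∑ xs, G x xs := by
    have := Finset.sum_le_sum fun x (_ : x ∈ (univ : Finset 𝒳)) =>
      Finset.sum_le_sum fun xs (_ : xs ∈ (univ : Finset 𝒳)) => hgoodpt x xs
    simp only [Finset.sum_sub_distrib] at this
    linarith
  -- assemble
  have hreorder : ∑ x, ∑ xs, ∑ i : Fin M, ∑ κ, ind x κ i xs / ((sib f hp x κ i).card : ℝ) =
      ∑ x, ∑ κ, ∑ i : Fin M, ∑ xs, ind x κ i xs / ((sib f hp x κ i).card : ℝ) := by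
    refine Finset.sum_congr rfl fun x _ => ?_
    trans ∑ xs, ∑ κ, ∑ i : Fin M, ind x κ i xs / ((sib f hp x κ i).card : ℝ)
    · exact Finset.sum_congr rfl fun xs _ => Finset.sum_comm
    rw [Finset.sum_comm]
    exact Finset.sum_congr rfl fun κ _ => Finset.sum_comm
  have hmain : (X : ℝ) * K * lam / 12 ≤
      ∑ x, ∑ κ, ∑ i : Fin M, (Real.logb 2 (sib f hp x κ i).card - Real.logb 2 (acc f hp T x κ i).card) := by
    calc (X : ℝ) * K * lam / 12 = ((X : ℝ) ^ 2 / 4) * (lam * (K / (3 * X))) := by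
          field_simp; ring
      _ ≤ (∑ x, ∑ xs, G x xs) * (lam * (K / (3 * X))) :=
          mul_le_mul_of_nonneg_right hgoodcount (by positivity)
      _ = ∑ x, ∑ xs, G x xs * (lam * (K / (3 * X))) := by
          rw [Finset.sum_mul]
          exact Finset.sum_congr rfl fun x _ => Finset.sum_mul _ _ _
      _ ≤ ∑ x, ∑ xs, ∑ i : Fin M, ∑ κ, ind x κ i xs / ((sib f hp x κ i).card : ℝ) := by
          refine Finset.sum_le_sum fun x _ => Finset.sum_le_sum fun xs _ => ?_
          simp only [hG]
          split_ifs with hgood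
          · rw [one_mul]; exact hinner x xs ⟨hgood.1, hgood.2.1, not_lt.1 hgood.2.2⟩
          · rw [zero_mul]
            exact Finset.sum_nonneg fun i _ => Finset.sum_nonneg fun κ _ =>
              div_nonneg (hind0 x κ i xs) (Nat.cast_nonneg _)
      _ = ∑ x, ∑ κ, ∑ i : Fin M, (∑ xs, ind x κ i xs) / ((sib f hp x κ i).card : ℝ) := by
          rw [hreorder]
          simp only [Finset.sum_div]
      _ ≤ _ := Finset.sum_le_sum fun x _ => Finset.sum_le_sum fun κ _ => Finset.sum_le_sum fun i _ =>
          hpt x κ i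
  simp only [Finset.sum_sub_distrib] at hmain
  have hcast : (Fintype.card 𝒳 : ℝ) * (Fintype.card 𝒦) * (Nat.log 2 T) / 12 = (X : ℝ) * K * lam / 12 := by
    rw [hXdef, hKdef, hlam]
  linarith

end Claim47

/-! ### Claim 4.6: escaping the accessible set inverts `f` -/

section Claim46

variable [Fintype 𝒦] [DecidableEq P]
variable {f : 𝒳 → 𝒴} {hp : 𝒦 → ℕ → 𝒴 → P} {M : ℕ}

/-- The keys under which the challenge `y = f x₀` is an `i`-prefix sibling of `f x`:
`G_{y,x,i} = {κ : h_κ(y)_{1..i} = h_κ(f x)_{1..i}}`. [cite: HaitnerEtAl2020, proof of Claim 4.6 (the inverter `Inv`)] -/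
def plantKeys (f : 𝒳 → 𝒴) (hp : 𝒦 → ℕ → 𝒴 → P) (x₀ x : 𝒳) (i : ℕ) : Finset 𝒦 :=
  univ.filter fun κ => hp κ i (f x₀) = hp κ i (f x)

/-- `G_{f x₀, x, i}` is nonempty (it contains the keys under which even the full values agree, in
particular it is all of `𝒦` when `f x₀ = f x`; in general nonemptiness follows from pairwise
independence, `|G| · 2^i = |𝒦|`). Here: the membership test. [cite: HaitnerEtAl2020, proof of Claim 4.6] -/
@[simp] theorem mem_plantKeys {x₀ x : 𝒳} {i : ℕ} {κ : 𝒦} :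
    κ ∈ plantKeys f hp x₀ x i ↔ hp κ i (f x₀) = hp κ i (f x) := by
  simp [plantKeys]

variable [Fintype 𝒳] [DecidableEq 𝒴] {Ω : Type*} [Fintype Ω]

/-- **The inverter's success count.** `Inv^A(y)` for `y = f x₀`: pick `x ← 𝒳`, `i ← [M]`, a key
`κ ← G_{y,x,i}` uniformly, coins `r`, and output `A(x, κ, i; r)`; it succeeds when `f(A(…)) = y`.
`invSum` is `Σ_{x₀, x, i} E_{κ ← G}[#{r : success}]`, i.e. `|𝒳|² M |Ω| · Pr[Inv^A(f(X₀)) ∈ f⁻¹(f(X₀))]`.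
[cite: HaitnerEtAl2020, proof of Claim 4.6, Eq. (4.8)] -/
noncomputable def invSum (f : 𝒳 → 𝒴) (hp : 𝒦 → ℕ → 𝒴 → P) (M : ℕ) (A : 𝒳 → 𝒦 → ℕ → Ω → 𝒳) : ℝ :=
  ∑ x₀, ∑ x, ∑ i : Fin M,
    (∑ κ ∈ plantKeys f hp x₀ x i, ∑ r, if f (A x κ i r) = f x₀ then (1 : ℝ) else 0) /
      ((plantKeys f hp x₀ x i).card : ℝ)

/-- **The escape count**: the number of `(x, κ, i, r)` for which the collision finder's output
`A(x, κ, i; r)` lies outside `L(x, κ, i)`, i.e. has an image different from `f x` that is not `i`-light.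
(the paper's `Pr(A(Z; R) ∉ L(Z))`). [cite: HaitnerEtAl2020, Claim 4.6 with Eq. (4.6)] -/
noncomputable def escCount (f : 𝒳 → 𝒴) (T M : ℕ) (A : 𝒳 → 𝒦 → ℕ → Ω → 𝒳) : ℝ :=
  ∑ x, ∑ κ, ∑ i : Fin M, ∑ r,
    if f (A x κ i r) ≠ f x ∧ ¬ IsLight f T i (f (A x κ i r)) then (1 : ℝ) else 0

/-- **Claim 4.6** (HHRVW 2020), counted form: for every `F`-collision finder `A` (its output is always an
`i`-prefix sibling of the input), `|𝒳| · escCount ≤ T · |𝒦| · invSum`, i.e.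
`Pr[A(Z;R) ∉ L(Z)] ≤ T · Pr[Inv^A(f(X₀)) ∈ f⁻¹(f(X₀))]` after normalisation (the paper's factor `n^c`
is `T`). Ingredients as printed: an output with image `y ∉ L̃(f x, i)` has `Pr[f(X) = y] ≥ 2^{-i}/T`
(not light), and for `y ≠ f x` conditioning the key on `G_{y,x,i}` costs exactly the factor `2^i`
by pairwise independence, the collision-finder property making the conditioning event automatic
(Eq. (4.9)). [cite: HaitnerEtAl2020, Claim 4.6, Eq. (4.7)–(4.9)] -/
theorem card_mul_escCount_le [Nonempty 𝒦] (h2 : PrefixPairwise f hp M) {T : ℕ} (hT : 0 < T)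
    (A : 𝒳 → 𝒦 → ℕ → Ω → 𝒳) (hA : ∀ x κ, ∀ i < M, ∀ r, hp κ i (f (A x κ i r)) = hp κ i (f x)) :
    (Fintype.card 𝒳 : ℝ) * escCount f T M A ≤ T * Fintype.card 𝒦 * invSum f hp M A := by
  classical
  set X := Fintype.card 𝒳 with hXdef
  set K := Fintype.card 𝒦 with hKdef
  have hT0 : (0 : ℝ) < T := by exact_mod_cast hT
  -- the escape predicate of an image relative to `(x, i)`
  set esc : 𝒳 → ℕ → 𝒳 → Prop := fun x i x' => f x' ≠ f x ∧ ¬ IsLight f T i (f x') with hesc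
  -- Step 1: for `(x, i, x₀)` with `x₀` escaping, the planted term equals `2^i/K · Σ_{κ,r} 1[f A = f x₀]`
  have hterm : ∀ (x x₀ : 𝒳) (i : ℕ), i < M → esc x i x₀ →
      (∑ κ ∈ plantKeys f hp x₀ x i, ∑ r, if f (A x κ i r) = f x₀ then (1 : ℝ) else 0) /
          ((plantKeys f hp x₀ x i).card : ℝ) =
        (2 : ℝ) ^ i / K * ∑ κ, ∑ r, if f (A x κ i r) = f x₀ then (1 : ℝ) else 0 := by
    intro x x₀ i hi he
    have hG : (plantKeys f hp x₀ x i).card * 2 ^ i = K := h2 i hi x x₀ (Ne.symm he.1)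
    have hGR : ((plantKeys f hp x₀ x i).card : ℝ) = K / 2 ^ i := by
      rw [eq_div_iff (by positivity)]; exact_mod_cast hG
    -- the sum over `G` is the full sum (collision-finder property)
    have hfull : (∑ κ ∈ plantKeys f hp x₀ x i, ∑ r, if f (A x κ i r) = f x₀ then (1 : ℝ) else 0) =
        ∑ κ, ∑ r, if f (A x κ i r) = f x₀ then (1 : ℝ) else 0 := by
      rw [plantKeys, Finset.sum_filter]
      refine Finset.sum_congr rfl fun κ _ => ?_
      split_ifs with hκ
      · rfl
      · refine (Finset.sum_eq_zero fun r _ => ?_).symm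
        rw [if_neg]
        intro hEq
        exact hκ (by rw [← hEq, hA x κ i hi r])
    rw [hfull, hGR]
    have hK0 : (K : ℝ) ≠ 0 := by
      have : 0 < K := by rw [hKdef]; exact Fintype.card_pos
      exact_mod_cast this.ne'
    field_simp
  have hK0 : (0 : ℝ) < K := by rw [hKdef]; exact_mod_cast Fintype.card_pos
  have hind0 : ∀ (p : Prop) [Decidable p], (0 : ℝ) ≤ (if p then (1 : ℝ) else 0) := fun p _ => by
    split_ifs <;> norm_num
  -- Step 2: for fixed `(x, i)`, summing the planted terms over the challenge `x₀`
  have hxi : ∀ (x : 𝒳) (i : ℕ), i < M →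
      (X : ℝ) / (T * K) * ∑ κ, ∑ r, (if esc x i (A x κ i r) then (1 : ℝ) else 0) ≤
        ∑ x₀, (∑ κ ∈ plantKeys f hp x₀ x i, ∑ r, if f (A x κ i r) = f x₀ then (1 : ℝ) else 0) /
          ((plantKeys f hp x₀ x i).card : ℝ) := by
    intro x i hi
    -- lower bound each `x₀`-term by its escaping part
    have hlow : ∀ x₀, (if esc x i x₀ then (1 : ℝ) else 0) *
        ((2 : ℝ) ^ i / K * ∑ κ, ∑ r, if f (A x κ i r) = f x₀ then (1 : ℝ) else 0) ≤
        (∑ κ ∈ plantKeys f hp x₀ x i, ∑ r, if f (A x κ i r) = f x₀ then (1 : ℝ) else 0) /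
          ((plantKeys f hp x₀ x i).card : ℝ) := by
      intro x₀
      split_ifs with he
      · rw [one_mul, hterm x x₀ i hi he]
      · rw [zero_mul]
        exact div_nonneg (Finset.sum_nonneg fun κ _ => Finset.sum_nonneg fun r _ => hind0 _)
          (Nat.cast_nonneg _)
    refine le_trans ?_ (Finset.sum_le_sum fun x₀ _ => hlow x₀)
    -- push the products inside and reorder to `Σ_κ Σ_r Σ_{x₀}`
    simp only [Finset.mul_sum]
    have hre : ∑ x₀, ∑ κ, ∑ r, (if esc x i x₀ then (1 : ℝ) else 0) *
        ((2 : ℝ) ^ i / K * (if f (A x κ i r) = f x₀ then (1 : ℝ) else 0)) =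
        ∑ κ, ∑ r, ∑ x₀, (if esc x i x₀ then (1 : ℝ) else 0) *
          ((2 : ℝ) ^ i / K * (if f (A x κ i r) = f x₀ then (1 : ℝ) else 0)) := by
      rw [Finset.sum_comm]
      exact Finset.sum_congr rfl fun κ _ => Finset.sum_comm
    rw [hre]
    refine Finset.sum_le_sum fun κ _ => Finset.sum_le_sum fun r _ => ?_
    -- pointwise in `(κ, r)`
    by_cases he : esc x i (A x κ i r)
    · rw [if_pos he, mul_one]
      have hpt : ∀ x₀, (if esc x i x₀ then (1 : ℝ) else 0) *
          ((2 : ℝ) ^ i / K * (if f (A x κ i r) = f x₀ then (1 : ℝ) else 0)) =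
          (2 : ℝ) ^ i / K * (if f x₀ = f (A x κ i r) then (1 : ℝ) else 0) := by
        intro x₀
        by_cases hx₀ : f x₀ = f (A x κ i r)
        · have hex₀ : esc x i x₀ := by
            simp only [hesc] at he ⊢
            rw [hx₀]; exact he
          rw [if_pos hex₀, if_pos hx₀.symm, if_pos hx₀, one_mul]
        · rw [if_neg (show ¬ (f (A x κ i r) = f x₀) from fun h => hx₀ h.symm), if_neg hx₀]
          simp only [mul_zero]
      rw [Finset.sum_congr rfl fun x₀ _ => hpt x₀, ← Finset.mul_sum]
      have hN : (∑ x₀, (if f x₀ = f (A x κ i r) then (1 : ℝ) else 0)) = imgCard f (f (A x κ i r)) := by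
        rw [imgCard_apply, Finset.card_filter]; push_cast; rfl
      rw [hN]
      have hnl : X < imgCard f (f (A x κ i r)) * T * 2 ^ i := by
        have := he.2
        simp only [IsLight, not_le] at this
        rw [hXdef]; exact this
      have hnlR : (X : ℝ) ≤ imgCard f (f (A x κ i r)) * T * 2 ^ i := by exact_mod_cast hnl.le
      rw [div_le_iff₀ (by positivity)]
      calc (X : ℝ) ≤ imgCard f (f (A x κ i r)) * T * 2 ^ i := hnlR
        _ = (2 : ℝ) ^ i / K * imgCard f (f (A x κ i r)) * (T * K) := by
          field_simp
    · rw [if_neg he, mul_zero]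
      exact Finset.sum_nonneg fun x₀ _ => mul_nonneg (hind0 _) (mul_nonneg (by positivity) (hind0 _))
  -- Step 3: sum over `(x, i)` and reorder
  have hinv : invSum f hp M A = ∑ x, ∑ i : Fin M, ∑ x₀,
      (∑ κ ∈ plantKeys f hp x₀ x i, ∑ r, if f (A x κ i r) = f x₀ then (1 : ℝ) else 0) /
        ((plantKeys f hp x₀ x i).card : ℝ) := by
    rw [invSum, Finset.sum_comm]
    exact Finset.sum_congr rfl fun x _ => Finset.sum_comm
  have hescC : escCount f T M A = ∑ x, ∑ i : Fin M, ∑ κ, ∑ r, (if esc x i (A x κ i r) then (1 : ℝ) else 0) := by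
    rw [escCount]
    exact Finset.sum_congr rfl fun x _ => Finset.sum_comm
  have htot : (X : ℝ) / (T * K) * escCount f T M A ≤ invSum f hp M A := by
    rw [hinv, hescC, Finset.mul_sum]
    refine Finset.sum_le_sum fun x _ => ?_
    rw [Finset.mul_sum]
    exact Finset.sum_le_sum fun i _ => hxi x i i.isLt
  have hTK : (0 : ℝ) < T * K := mul_pos hT0 hK0
  rw [div_mul_eq_mul_div, div_le_iff₀ hTK] at htot
  linarith

end Claim46

end HHRVW

end Literature.Computability.Cryptography
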